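import Mathlib
import HarnessLib
import Summits.Ventures.LatticeQCDFlow.Exactness.SampleESS

/-!
# The Kish effective sample size is SUBADDITIVE under pooling: `ESS(all records) ≤ Σ_r ESS(block r)`, so the pooled ESS fraction is at most the size-weighted average of the block fractions

HONEST FRAMING: exact (Metropolis-corrected) sampling algorithms for lattice gauge theory;
figures of merit are autocorrelation/cost numbers at stated couplings and volumes; no
continuum-physics claim.

Venture `LatticeQCDFlow` (cell pub-lqcd), topic `Exactness`; FANOUT row 13 (`eng-snf`, GEN-25).
NEW WORK of the cell (elementary: Sedrakyan's form of the Cauchy–Schwarz inequality,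
`Finset.sq_sum_div_le_sum_sq_div`), Mathlib + row 19's `Exactness/SampleESS` (`essHat`); not a
published result; no definition; nothing cited as a fact ("the ESS is not additive" NAMED ONLY).

WHY (row 13).  `latflow-snf`'s `estimators.ess_kish` prints the Kish effective sample size
`ESS = (Σ_i w_i)²/Σ_i w_i²` of the POOLED record set of a run (`free_energy`'s `ess`; FITNESS §1
exactness modes board the fraction `ESS/N`, row 19 `essHat`), while streams / blocks are also
scored separately.  How do the two relate?  For every family of blocks with nonnegative weights
(each block carrying some weight): `ESS_pooled ≤ Σ_r ESS_r` (Sedrakyan with `f_r = Σ_{i∈r} w_i`,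
`g_r = Σ_{i∈r} w_i²`), with equality iff the blocks' mean-weight levels `Σ_{i∈r} w_i / Σ_{i∈r} w_i²`
agree; hence the pooled FRACTION `ESS_pooled/N` is at most the size-weighted average
`Σ_r (n_r/N)·(ESS_r/n_r)` of the block fractions, in particular at most the largest block fraction:
pooling streams at different dissipation levels never manufactures effective samples, and a
degenerate block (constant weights, `ESS_r/n_r = 1`, row 19's planted-control signature) cannot
raise the pooled fraction above the average of the honest ones weighted by size.

* **`sq_sum_sum_div_le_sum_sq_sum_div`** (§1) —
  `(Σ_r Σ_j w_{rj})²/(Σ_r Σ_j w_{rj}²) ≤ Σ_r (Σ_j w_{rj})²/(Σ_j w_{rj}²)`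
  (blocks `r : ι`, records `j : J r`, every block with `Σ_j w² > 0`).
* **`essHat_sigma_mul_card_le`** (§2) — `N · essHat(pooled) ≤ Σ_r n_r · essHat(w_r)` on the pooled
  index type `Σ r, J r`; **`essHat_sigma_le_weightedAvg`** —
  `essHat(pooled) ≤ Σ_r (n_r/N) essHat(w_r)`; **`essHat_sigma_le_sup`** — `≤ max_r essHat(w_r)`.

NOT CLAIMED: anything about the population ESS `1/E e^{−2W_d}` (GEN-13/14); anything numerical.
-/

namespace Summit.Ventures.LatticeQCDFlow.Exactness.GeneralNCMC

open Finset Summit.Ventures.LatticeQCDFlow.Exactness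

/-! ## §1 Sedrakyan: the pooled Kish ESS is at most the sum of the block ESS -/

section Raw

variable {ι : Type*} [Fintype ι] {J : ι → Type*} [∀ r, Fintype (J r)]

/-- **`ESS(pooled) ≤ Σ_r ESS(block r)`**: for blockwise weights `w r : J r → ℝ` with every block
carrying weight (`Σ_j (w r j)² > 0`),
`(Σ_r Σ_j w_{rj})² / (Σ_r Σ_j w_{rj}²) ≤ Σ_r (Σ_j w_{rj})² / (Σ_j w_{rj}²)`. -/
theorem sq_sum_sum_div_le_sum_sq_sum_div (w : (r : ι) → J r → ℝ)
    (hpos : ∀ r, 0 < ∑ j, w r j ^ 2) :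
    (∑ r, ∑ j, w r j) ^ 2 / (∑ r, ∑ j, w r j ^ 2) ≤ ∑ r, (∑ j, w r j) ^ 2 / ∑ j, w r j ^ 2 :=
  Finset.sq_sum_div_le_sum_sq_div univ (fun r => ∑ j, w r j) fun r _ => hpos r

/-- The same with the pooled sums written over the pooled index type `Σ r, J r`. -/
theorem sq_sum_sigma_div_le (w : (r : ι) → J r → ℝ) (hpos : ∀ r, 0 < ∑ j, w r j ^ 2) :
    (∑ p : (Σ r, J r), w p.1 p.2) ^ 2 / (∑ p : (Σ r, J r), w p.1 p.2 ^ 2)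
      ≤ ∑ r, (∑ j, w r j) ^ 2 / ∑ j, w r j ^ 2 := by
  have h1 : (∑ p : (Σ r, J r), w p.1 p.2) = ∑ r, ∑ j, w r j := by
    rw [← Finset.univ_sigma_univ, Finset.sum_sigma]
  have h2 : (∑ p : (Σ r, J r), w p.1 p.2 ^ 2) = ∑ r, ∑ j, w r j ^ 2 := by
    rw [← Finset.univ_sigma_univ, Finset.sum_sigma]
  rw [h1, h2]
  exact sq_sum_sum_div_le_sum_sq_sum_div w hpos

end Raw

/-! ## §2 The boarded FRACTION: `essHat(pooled) ≤ Σ_r (n_r/N) · essHat(block r) ≤ max_r` -/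

section Fraction

variable {ι : Type*} [Fintype ι] {J : ι → Type*} [∀ r, Fintype (J r)]

/-- `essHat` of a block times its size is its Kish ESS. -/
theorem card_mul_essHat_eq {κ : Type*} [Fintype κ] (v : κ → ℝ) (hpos : 0 < ∑ j, v j ^ 2)
    (hcard : 0 < Fintype.card κ) :
    (Fintype.card κ : ℝ) * essHat v = (∑ j, v j) ^ 2 / ∑ j, v j ^ 2 := by
  unfold essHat
  have hc : (Fintype.card κ : ℝ) ≠ 0 := by positivity
  field_simp

/-- **`N · essHat(pooled) ≤ Σ_r n_r · essHat(w_r)`** — the pooled Kish ESS is at most the sum of the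
block ESS (every block nonempty and carrying weight). -/
theorem essHat_sigma_mul_card_le (w : (r : ι) → J r → ℝ) (hpos : ∀ r, 0 < ∑ j, w r j ^ 2)
    (hne : ∀ r, 0 < Fintype.card (J r)) :
    (Fintype.card (Σ r, J r) : ℝ) * essHat (fun p : (Σ r, J r) => w p.1 p.2)
      ≤ ∑ r, (Fintype.card (J r) : ℝ) * essHat (w r) := by
  rcases isEmpty_or_nonempty ι with hι | hι
  · simp [essHat]
  have hposS : 0 < ∑ p : (Σ r, J r), w p.1 p.2 ^ 2 := by
    rw [← Finset.univ_sigma_univ, Finset.sum_sigma]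
    exact sum_pos (fun r _ => hpos r) univ_nonempty
  have hcardS : 0 < Fintype.card (Σ r, J r) := by
    rw [Fintype.card_sigma]
    exact sum_pos (fun r _ => hne r) univ_nonempty
  rw [card_mul_essHat_eq _ hposS hcardS]
  simp_rw [card_mul_essHat_eq _ (hpos _) (hne _)]
  exact sq_sum_sigma_div_le w hpos

/-- **THE POOLED ESS FRACTION IS AT MOST THE SIZE-WEIGHTED AVERAGE OF THE BLOCK FRACTIONS**:
`essHat(pooled) ≤ Σ_r (n_r/N) · essHat(w_r)`, `N = Σ_r n_r`. -/
theorem essHat_sigma_le_weightedAvg (w : (r : ι) → J r → ℝ) (hpos : ∀ r, 0 < ∑ j, w r j ^ 2)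
    (hne : ∀ r, 0 < Fintype.card (J r)) :
    essHat (fun p : (Σ r, J r) => w p.1 p.2)
      ≤ ∑ r, (Fintype.card (J r) : ℝ) / Fintype.card (Σ r, J r) * essHat (w r) := by
  rcases isEmpty_or_nonempty ι with hι | hι
  · simp [essHat]
  have hcardS : (0 : ℝ) < Fintype.card (Σ r, J r) := by
    rw [Fintype.card_sigma]
    exact_mod_cast sum_pos (fun r _ => hne r) univ_nonempty
  have h := essHat_sigma_mul_card_le w hpos hne
  rw [mul_comm] at h
  rw [← le_div_iff₀ hcardS] at h
  refine h.trans (le_of_eq ?_)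
  rw [sum_div]
  exact sum_congr rfl fun r _ => by ring

/-- **… AND AT MOST THE LARGEST BLOCK FRACTION**: `essHat(pooled) ≤ max_r essHat(w_r)`. -/
theorem essHat_sigma_le_sup [Nonempty ι] (w : (r : ι) → J r → ℝ) (hpos : ∀ r, 0 < ∑ j, w r j ^ 2)
    (hne : ∀ r, 0 < Fintype.card (J r)) :
    essHat (fun p : (Σ r, J r) => w p.1 p.2) ≤ univ.sup' univ_nonempty fun r => essHat (w r) := by
  have hcardS : (0 : ℝ) < Fintype.card (Σ r, J r) := by
    rw [Fintype.card_sigma]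
    exact_mod_cast sum_pos (fun r _ => hne r) univ_nonempty
  refine (essHat_sigma_le_weightedAvg w hpos hne).trans ?_
  calc ∑ r, (Fintype.card (J r) : ℝ) / Fintype.card (Σ r, J r) * essHat (w r)
      ≤ ∑ r, (Fintype.card (J r) : ℝ) / Fintype.card (Σ r, J r)
          * univ.sup' univ_nonempty (fun r => essHat (w r)) :=
        sum_le_sum fun r _ => mul_le_mul_of_nonneg_left
          (le_sup' (fun r => essHat (w r)) (mem_univ r)) (by positivity)
    _ = univ.sup' univ_nonempty (fun r => essHat (w r)) := by
        have hN : (∑ r, (Fintype.card (J r) : ℝ)) = Fintype.card (Σ r, J r) := by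
          rw [Fintype.card_sigma]; push_cast; rfl
        rw [← sum_mul, ← sum_div, hN, div_self hcardS.ne', one_mul]

end Fraction

end Summit.Ventures.LatticeQCDFlow.Exactness.GeneralNCMC
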